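import Mathlib
import Summits.QuantumFields.YangMills.Theorems.EguchiKawaiDirectionLadderGaussianQuadraticChernoff
import Summits.QuantumFields.YangMills.Theorems.EguchiKawaiDirectionLadderDetRankOnePeeling
import Summits.QuantumFields.YangMills.Theorems.EguchiKawaiDirectionLadderHaarNestedPattern
import HarnessLib

/-!
# One Gram–Schmidt column against a weighted quadratic form

The WEIGHTED (multiscale) version of the conditional column bound `stdGaussian_measure_column_event_le`
(route `EguchiKawaiDirectionLadder`, crux `TripleSmallBallMargin`, stub plan A1 «generic-region count»):
for a subspace `K ⊆ ℂ^N` with orthonormal basis `e₀,…,e_{k-1}`, weights `a_j ≥ 0` and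
`σ ≥ Σₗ Σⱼ a_j |e_l(j)|²` (the weighted mass of the previous columns),

  `γ{ g : Σⱼ a_j |(P_{Kᗮ} g)_j|² ≤ ‖P_{Kᗮ} g‖² } ≤ 2^N · e^{σ} · ∏ⱼ (1 + a_j)⁻¹`

(`stdGaussian_measure_weightedColumn_le`).  Proof: the event is contained in
`{g* (P D P) g ≤ ‖g‖²}` (`P` the matrix of `P_{Kᗮ}`, `D = diag a`), whose Gaussian measure is at most
`2^N / det(1 + P D P)` (`stdGaussian_measure_quadForm_le`); `det(1 + P D P) = det(1 + D^{1/2} P D^{1/2})`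
(Sylvester) and `D^{1/2} P D^{1/2} = D − Σₗ (D^{1/2}e_l)(D^{1/2}e_l)*`, so the rank-one peeling bound
`det_re_one_add_sub_sum_vecMulVec_ge` gives `det ≥ e^{−σ} ∏ (1 + a_j)`.  All [folklore].
-/

noncomputable section

open MeasureTheory ProbabilityTheory Matrix WithLp Finset Module Submodule
open Literature.Probability.Distributions
open scoped ENNReal ComplexOrder InnerProductSpace

namespace Summit.QuantumFields.YangMills.Theorems.EguchiKawaiDirectionLadder.HaarColumns

variable {N : ℕ}

/-- The inner product of `ℂ^N` as a Hermitian dot product: `⟪x, y⟫ = star x ⬝ᵥ y`. [folklore] -/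
theorem inner_eq_star_dotProduct' (x y : EuclideanSpace ℂ (Fin N)) :
    ⟪x, y⟫_ℂ = star (ofLp x) ⬝ᵥ ofLp y := by
  rw [EuclideanSpace.inner_eq_star_dotProduct, dotProduct_comm]

/-- **The matrix of `P_{Kᗮ}`**: for an orthonormal basis `e` of `K`,
`P_{Kᗮ} g = (1 − Σₗ e_l e_l*) g`. [folklore] -/
theorem ofLp_starProjection_orthogonal_eq_mulVec (K : Submodule ℂ (EuclideanSpace ℂ (Fin N)))
    {k : ℕ} (e : OrthonormalBasis (Fin k) ℂ K) (g : EuclideanSpace ℂ (Fin N)) :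
    ofLp (Kᗮ.starProjection g) =
      (1 - ∑ l, vecMulVec (ofLp (e l : EuclideanSpace ℂ (Fin N)))
        (star (ofLp (e l : EuclideanSpace ℂ (Fin N))))) *ᵥ ofLp g := by
  rw [← sub_starProjection_eq K g, ← K.sum_inner_smul_eq_starProjection e g, sub_mulVec, one_mulVec,
    WithLp.ofLp_sub, WithLp.ofLp_sum, Matrix.sum_mulVec]
  congr 1
  refine Finset.sum_congr rfl fun l _ => ?_
  rw [WithLp.ofLp_smul, vecMulVec_mulVec, op_smul_eq_smul, inner_eq_star_dotProduct']

/-- **Conditional bound for one Gram–Schmidt column against a weighted form.** [folklore] -/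
theorem stdGaussian_measure_weightedColumn_le (K : Submodule ℂ (EuclideanSpace ℂ (Fin N)))
    {k : ℕ} (e : OrthonormalBasis (Fin k) ℂ K) (a : Fin N → ℝ) (ha : ∀ j, 0 ≤ a j) {σ : ℝ}
    (hσ : ∑ l, ∑ j, a j * ‖(e l : EuclideanSpace ℂ (Fin N)) j‖ ^ 2 ≤ σ) :
    stdGaussian (EuclideanSpace ℂ (Fin N))
        {g | ∑ j, a j * ‖(Kᗮ.starProjection g) j‖ ^ 2 ≤ ‖Kᗮ.starProjection g‖ ^ 2} ≤
      ENNReal.ofReal (2 ^ N * Real.exp σ * ∏ j, (1 + a j)⁻¹) := by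
  classical
  set V := EuclideanSpace ℂ (Fin N) with hV
  set E : Fin k → Fin N → ℂ := fun l => ofLp (e l : EuclideanSpace ℂ (Fin N)) with hE
  -- orthonormality in dot-product form
  have horth : ∀ l m, star (E l) ⬝ᵥ E m = if l = m then 1 else 0 := by
    intro l m
    have h := (orthonormal_iff_ite.1 e.orthonormal) l m
    rw [← inner_eq_star_dotProduct', ← Submodule.coe_inner, h]
  -- the matrix of the projection
  set P : Matrix (Fin N) (Fin N) ℂ := 1 - ∑ l, vecMulVec (E l) (star (E l)) with hP
  have hPapp : ∀ g : EuclideanSpace ℂ (Fin N), ofLp (Kᗮ.starProjection g) = P *ᵥ ofLp g :=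
    fun g => ofLp_starProjection_orthogonal_eq_mulVec K e g
  have hGherm : (∑ l, vecMulVec (E l) (star (E l)))ᴴ = ∑ l, vecMulVec (E l) (star (E l)) := by
    rw [conjTranspose_sum]
    refine Finset.sum_congr rfl fun l _ => ?_
    rw [conjTranspose_vecMulVec, star_star]
  have hPherm : Pᴴ = P := by
    rw [hP, conjTranspose_sub, conjTranspose_one, hGherm]
  have hGG : (∑ l, vecMulVec (E l) (star (E l))) * (∑ l, vecMulVec (E l) (star (E l))) =
      ∑ l, vecMulVec (E l) (star (E l)) := by
    rw [Finset.sum_mul]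
    refine Finset.sum_congr rfl fun l _ => ?_
    rw [Finset.mul_sum]
    rw [Finset.sum_eq_single l]
    · rw [vecMulVec_mul_vecMulVec, horth, if_pos rfl, one_smul]
    · intro m _ hml
      rw [vecMulVec_mul_vecMulVec, horth, if_neg (Ne.symm hml), zero_smul]
      ext i j; simp [vecMulVec_apply]
    · intro h; exact absurd (Finset.mem_univ l) h
  have hPidem : P * P = P := by
    rw [hP, sub_mul, one_mul, mul_sub, mul_one, hGG, sub_self, sub_zero]
  have hPpsd : P.PosSemidef := by
    have := posSemidef_conjTranspose_mul_self P
    rwa [hPherm, hPidem] at this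
  -- the weights
  set D : Matrix (Fin N) (Fin N) ℂ := diagonal fun j => ((a j : ℝ) : ℂ) with hD
  set S : Matrix (Fin N) (Fin N) ℂ := diagonal fun j => ((Real.sqrt (a j) : ℝ) : ℂ) with hS
  have hSS : S * S = D := by
    rw [hS, hD, diagonal_mul_diagonal]
    congr 1; funext j
    rw [← Complex.ofReal_mul, Real.mul_self_sqrt (ha j)]
  have hSherm : Sᴴ = S := by
    rw [hS, diagonal_conjTranspose]
    congr 1; funext j
    rw [Pi.star_apply, Complex.star_def, Complex.conj_ofReal]
  have hDpsd : D.PosSemidef := by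
    rw [hD, posSemidef_diagonal_iff]
    intro j; exact Complex.zero_le_real.2 (ha j)
  set Q : Matrix (Fin N) (Fin N) ℂ := P * D * P with hQ
  have hQpsd : Q.PosSemidef := by
    have := hDpsd.conjTranspose_mul_mul_same P
    rwa [hPherm] at this
  -- the quadratic form of `Q`
  have hquad : ∀ x : Fin N → ℂ, star x ⬝ᵥ Q *ᵥ x =
      ((∑ j, a j * ‖(P *ᵥ x) j‖ ^ 2 : ℝ) : ℂ) := by
    intro x
    have h1 : star x ⬝ᵥ Q *ᵥ x = star (P *ᵥ x) ⬝ᵥ D *ᵥ (P *ᵥ x) := by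
      rw [hQ, ← mulVec_mulVec, ← mulVec_mulVec, dotProduct_mulVec, star_mulVec, hPherm]
    rw [h1, dotProduct, Complex.ofReal_sum]
    refine Finset.sum_congr rfl fun j _ => ?_
    rw [hD, mulVec_diagonal, Pi.star_apply, Complex.star_def]
    push_cast
    rw [← Complex.conj_mul']
    ring
  -- the event is contained in the quadratic-form event
  have hsub : {g : EuclideanSpace ℂ (Fin N) | ∑ j, a j * ‖(Kᗮ.starProjection g) j‖ ^ 2 ≤
        ‖Kᗮ.starProjection g‖ ^ 2} ⊆
      {g | (star (ofLp g) ⬝ᵥ Q *ᵥ ofLp g).re ≤ 1 * ‖g‖ ^ 2} := by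
    intro g hg
    rw [Set.mem_setOf_eq] at hg ⊢
    rw [hquad, Complex.ofReal_re, ← hPapp, one_mul]
    exact hg.trans (by
      have := norm_starProjection_apply_le (K := Kᗮ) g
      exact pow_le_pow_left₀ (norm_nonneg _) this 2)
  -- Chernoff
  have hcher := stdGaussian_measure_quadForm_le hQpsd one_pos
  have hone : (1 : Matrix (Fin N) (Fin N) ℂ) + ((1 : ℝ)⁻¹ : ℂ) • Q = 1 + Q := by
    simp
  rw [hone] at hcher
  -- Sylvester: `det(1 + P D P) = det(1 + S P S)`
  have hsyl : (1 + Q).det = (1 + S * P * S).det := by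
    rw [hQ, ← hSS, show P * (S * S) * P = (P * S) * (S * P) by simp only [Matrix.mul_assoc],
      Matrix.det_one_add_mul_comm,
      show S * P * (P * S) = S * (P * P) * S by simp only [Matrix.mul_assoc], hPidem]
  -- `S P S = D − Σ v_l v_l*`
  set v : Fin k → Fin N → ℂ := fun l => S *ᵥ E l with hv
  have hSPS : S * P * S = D - ∑ l, vecMulVec (v l) (star (v l)) := by
    rw [hP, Matrix.mul_sub, Matrix.sub_mul, Matrix.mul_one, hSS, Matrix.mul_sum, Finset.sum_mul]
    congr 1
    refine Finset.sum_congr rfl fun l _ => ?_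
    rw [mul_vecMulVec, vecMulVec_mul, hv]
    congr 1
    rw [star_mulVec, hSherm]
  have hSPSpsd : (D - ∑ l, vecMulVec (v l) (star (v l))).PosSemidef := by
    rw [← hSPS]
    have := hPpsd.conjTranspose_mul_mul_same S
    rwa [hSherm] at this
  -- rank-one peeling
  have hpeel := det_re_one_add_sub_sum_vecMulVec_ge k D v hSPSpsd
  have hvnorm : ∑ l, ∑ i, ‖v l i‖ ^ 2 = ∑ l, ∑ j, a j * ‖(e l : EuclideanSpace ℂ (Fin N)) j‖ ^ 2 := by
    refine Finset.sum_congr rfl fun l _ => Finset.sum_congr rfl fun j _ => ?_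
    rw [hv]
    dsimp only
    rw [hS, mulVec_diagonal, norm_mul, mul_pow, Complex.norm_real, Real.norm_eq_abs,
      sq_abs, Real.sq_sqrt (ha j)]
  have hdetD : (1 + D).det.re = ∏ j, (1 + a j) := by
    rw [hD, ← diagonal_one, diagonal_add, det_diagonal]
    show (∏ i : Fin N, ((1 : ℂ) + ((a i : ℝ) : ℂ))).re = _
    have h : (∏ i : Fin N, ((1 : ℂ) + ((a i : ℝ) : ℂ))) = ((∏ j, (1 + a j) : ℝ) : ℂ) := by
      push_cast; rfl
    rw [h, Complex.ofReal_re]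
  have hprod0 : 0 < ∏ j, (1 + a j) := Finset.prod_pos fun j _ => by linarith [ha j]
  -- the determinant is at least `e^{-σ} ∏ (1 + a_j)`
  have hdetge : Real.exp (-σ) * ∏ j, (1 + a j) ≤ (1 + Q).det.re := by
    rw [hsyl, hSPS]
    refine le_trans ?_ hpeel
    rw [hvnorm, hdetD]
    exact mul_le_mul_of_nonneg_right (Real.exp_le_exp.2 (by linarith)) hprod0.le
  have hdetpos : 0 < (1 + Q).det.re := lt_of_lt_of_le (mul_pos (Real.exp_pos _) hprod0) hdetge
  -- conclude
  calc stdGaussian (EuclideanSpace ℂ (Fin N))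
        {g | ∑ j, a j * ‖(Kᗮ.starProjection g) j‖ ^ 2 ≤ ‖Kᗮ.starProjection g‖ ^ 2}
      ≤ stdGaussian (EuclideanSpace ℂ (Fin N))
          {g | (star (ofLp g) ⬝ᵥ Q *ᵥ ofLp g).re ≤ 1 * ‖g‖ ^ 2} := measure_mono hsub
    _ ≤ ENNReal.ofReal ((2 : ℝ) ^ N / (1 + Q).det.re) := hcher
    _ ≤ ENNReal.ofReal (2 ^ N * Real.exp σ * ∏ j, (1 + a j)⁻¹) := by
        refine ENNReal.ofReal_le_ofReal ?_
        rw [div_le_iff₀ hdetpos]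
        have h1 : (2 : ℝ) ^ N = (2 ^ N * Real.exp σ * ∏ j, (1 + a j)⁻¹) *
            (Real.exp (-σ) * ∏ j, (1 + a j)) := by
          rw [Finset.prod_inv_distrib, Real.exp_neg]
          field_simp
        have hC0 : 0 ≤ (2 : ℝ) ^ N * Real.exp σ * ∏ j, (1 + a j)⁻¹ :=
          mul_nonneg (mul_nonneg (pow_nonneg zero_le_two N) (Real.exp_pos _).le)
            (Finset.prod_nonneg fun j _ => inv_nonneg.2 (by linarith [ha j]))
        calc (2 : ℝ) ^ N = (2 ^ N * Real.exp σ * ∏ j, (1 + a j)⁻¹) * (Real.exp (-σ) * ∏ j, (1 + a j)) := h1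
          _ ≤ (2 ^ N * Real.exp σ * ∏ j, (1 + a j)⁻¹) * (1 + Q).det.re :=
              mul_le_mul_of_nonneg_left hdetge hC0


end Summit.QuantumFields.YangMills.Theorems.EguchiKawaiDirectionLadder.HaarColumns

end
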